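import Summits.QuantumFields.YangMills.Theorems.AllWindowsColdBoxBoxHighLineGhostTaylorEvenPrelims

/-!
# T-S5.7d⁽⁴⁾ `GhostTaylorEven` — the EVEN part of the Faddeev–Popov log-determinant in the edge chart equals the ghost quadratic form to FOURTH order:
# `|(ghostLogRatio a + ghostLogRatio (−a))/2 − quadVal (ghostM H) a| ≤ C·H⁸·(1+log H)⁸·t⁴`

Free-hands brick of LEAD ym-line-sfw-p2 g78 for planner ym-idea-2 g18's ★FLAG-2 (2026-08-30T01:19:49Z; K3′ row RA-ghost of U5 = `stub_landauThirdOrder`,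
⟨stmt-QuantumFields-24336⟩).  w3 g40's ✓`ghostTaylor` gives `|ghostLogRatio a − quadVal M_H a| ≤ C·H⁶(1+log H)⁴·t³`; the even symmetrisation kills the cubic
order.  Proof = the 7d assembly one order further, with NO third-order chart expansion: writing `X(±a) = ±X_A + X_B + X_R(±a)` (✓`fpOperator_edgeChart_sub_one`,
`chartL` odd, `chartQ` even), the symmetrised cubic chart remainder is already quartic — `chartR a e + chartR (−a) e = 2(cos‖v‖ − 1 + ‖v‖²/2)·1`, `‖·‖ ≤ (5/48)t⁴`
(the `sinc` term is odd and cancels) — and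

  `(g(a)+g(−a))/2 − quadVal = ½(r₄⁺ + r₄⁻) + ½tr(X_R⁺ + X_R⁻) − ½tr(X_A(X_R⁺ − X_R⁻)) − ¼(tr E₊² + tr E₋²) + ½(tr X_A²E₊ + tr X_A²E₋) + ½(tr X_AE₊² − tr X_AE₋²) + ⅙(tr E₊³ + tr E₋³)`

(`E± := X_B + X_R(±a)`, `tr X_A = 0` ✓`trace_ghostX_chartL`, `quadVal M_H a = tr X_B − ½tr X_A²` ✓`quadVal_ghostM`, `tr X_A³` cancels), where `r₄` is the THIRD-order
log-det remainder ✓`LogDetHS.logDet_hs4` (`≤ (ρ²/2)‖X‖²_HS ≍ H⁴t²·H⁴(log)⁴t²` — the `H⁸`), and every other term is `≤ C·κ^{3/2}·t⁴`, `κ ≍ H⁴(1+log H)⁴`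
(Hilbert–Schmidt sizes ✓`sum_sq_ghostX_le`, `|tr(PQ)| ≤ ‖P‖_HS‖Q‖_HS`, `‖PQ‖_HS ≤ ‖P‖_HS‖Q‖_HS`).

* ★★ `ghostTaylorEven` — the statement above with `m = 8`, `c₀ = 1/2688` (helpers, parity lemmas and the real bookkeeping `final_arith4` in
  ✓`…GhostTaylorEvenPrelims`).

Everything proved, Mathlib + tree only, standard axioms; no definitions.  HONEST LABEL: ONE brick of a K3′ row of an UNSTAFFED stub of a critic-PASSed DRAFT line;
U5, ⟨24004⟩, ⟨24336⟩ remain OPEN; no crux, rung or summit is proved; **the Yang–Mills mass gap is NOT proved by this file; no summit is proved by a line.**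
-/

set_option autoImplicit false

noncomputable section

open Matrix Finset
open scoped Matrix.Norms.Operator
open Literature.MathematicalPhysics.QuantumFieldTheory.Balaban1983to89.B10Eq18SigmaSU2 (su2Coord)
open Literature.MathematicalPhysics.QuantumFieldTheory.Balaban1983to89.B10Eq18SigmaSU2Haar (expPauli)
open Literature.MathematicalPhysics.QuantumFieldTheory.AxialGauge (boxEdges)
open Literature.MathematicalPhysics.QuantumLattice (LGConfig ZdEdge)
open Literature.Probability.LatticeModels (Site dirichletMatrix dirichletMatrix_transpose)

namespace Summit.QuantumFields.YangMills.Theorems.AllWindowsColdBoxBoxHighLine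

open GhostFP GhostTaylorProof in
/-- ★★ **T-S5.7d⁽⁴⁾ `GhostTaylorEven`** (`m = 8`, `c₀ = 1/2688`): for `H ≥ 1`, `0 ≤ t`, `t·H² ≤ c₀` and every edge field `‖a_e‖ ≤ t`,
`|(ghostLogRatio H a + ghostLogRatio H (−a))/2 − quadVal (ghostM H) a| ≤ C·H⁸·(1+log H)⁸·t⁴`. -/
theorem ghostTaylorEven : ∃ C c₀ : ℝ, ∃ m : ℕ, 0 < c₀ ∧ ∀ H : ℕ, 1 ≤ H → ∀ (t : ℝ) (a : LandauFree H → E3), 0 ≤ t → t * (H : ℝ) ^ 2 ≤ c₀ →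
    (∀ e, ‖a e‖ ≤ t) → |(ghostLogRatio H a + ghostLogRatio H (-a)) / 2 - quadVal (ghostM H) a| ≤ C * (H : ℝ) ^ 8 * (1 + Real.log H) ^ m * t ^ 4 := by
  obtain ⟨CG₀, hK⟩ := ghostKernelDecay
  obtain ⟨Cr, hCr0, hrow⟩ := OrbitMapSurj.interiorGreen_row_sq_le
  set CG : ℝ := max CG₀ 0 with hCGdef
  have hCG : 0 ≤ CG := le_max_right _ _
  -- κ = 331776·H⁴·Cr·L ≤ 331776·Cr·H⁴L; the constant absorbs κ², κH⁴, CG·H⁴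
  refine ⟨27776916 * 16 * 331776 * Cr + 15 * CG * 16 + 60 * 331776 * Cr + 60 * (331776 * Cr) ^ 2 + 60, 1 / 2688, 8, by norm_num,
    fun H hH t a ht0 htH hat => ?_⟩
  -- the Green's function facts at this `H`
  have hG0 : ∀ x z : ↥(interiorSites H), 0 ≤ (dirichletMatrix (interiorSites H))⁻¹ x z := fun x z => (hK H hH x z).1
  have hGd : ∀ x z : ↥(interiorSites H), (dirichletMatrix (interiorSites H))⁻¹ x z ≤ CG / (1 + siteDist (x : Site 4) (z : Site 4)) ^ 2 := by
    intro x z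
    refine (hK H hH x z).2.trans ?_
    have := GhostKernel.siteDist_nonneg (x : Site 4) (z : Site 4)
    exact div_le_div_of_nonneg_right (le_max_left _ _) (by positivity)
  have hGC : ∀ x z : ↥(interiorSites H), (dirichletMatrix (interiorSites H))⁻¹ x z ≤ CG := by
    intro x z
    refine (hGd x z).trans (div_le_self hCG ?_)
    have := GhostKernel.siteDist_nonneg (x : Site 4) (z : Site 4)
    exact one_le_pow₀ (by linarith)
  have hH' : (1 : ℝ) ≤ H := by exact_mod_cast hH
  have hlogH : 0 ≤ Real.log H := Real.log_nonneg hH'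
  set L : ℝ := (1 + Real.log H) ^ 4 with hLdef
  have hL : 1 ≤ L := one_le_pow₀ (by linarith)
  have hcol : ∀ z : ↥(interiorSites H), ∑ y, ((dirichletMatrix (interiorSites H))⁻¹ y z) ^ 2 ≤ Cr * L := by
    intro z
    have h := hrow H hH z
    rw [show (∑ y, ((dirichletMatrix (interiorSites H))⁻¹ y z) ^ 2) = ∑ y, ((dirichletMatrix (interiorSites H))⁻¹ z y) ^ 2 from
      Finset.sum_congr rfl fun y _ => by rw [green_symm]]
    exact h
  -- smallness
  have hc₀ : t * (H : ℝ) ^ 2 ≤ 1 / 2688 := htH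
  have hH2 : (1 : ℝ) ≤ (H : ℝ) ^ 2 := one_le_pow₀ hH'
  have ht1 : t ≤ 1 := by nlinarith
  have hat' : ∀ e : ZdEdge 4, ‖freeVec H a e‖ ≤ t := fun e => SmallFieldPlaq.norm_freeVec_le (fun e => hat e) ht0 e
  have hatm : ∀ e, ‖(-a) e‖ ≤ t := fun e => by rw [Pi.neg_apply, norm_neg]; exact hat e
  have hat'm : ∀ e : ZdEdge 4, ‖freeVec H (-a) e‖ ≤ t := fun e => SmallFieldPlaq.norm_freeVec_le (fun e => hatm e) ht0 e
  have hH0 : (0 : ℝ) ≤ H := Nat.cast_nonneg H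
  have hH4n : (0 : ℝ) ≤ 16 * (H : ℝ) ^ 4 := by positivity
  -- the two perturbations
  set F₁ := fpOperator H 1 with hF₁
  set Xp := F₁⁻¹ * (fpOperator H (edgeChart H a) - F₁) with hXp
  set Xm := F₁⁻¹ * (fpOperator H (edgeChart H (-a)) - F₁) with hXm
  set XA := ghostX H (chartL H a)
  set XB := ghostX H (chartQ H a)
  set XRp := ghostX H (chartR H a)
  set XRm := ghostX H (chartR H (-a))
  have hXpsplit : Xp = XA + XB + XRp := by
    rw [hXp, fpOperator_edgeChart_sub_one, Matrix.mul_add, Matrix.mul_add]; rfl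
  have hXmsplit : Xm = -XA + XB + XRm := by
    rw [hXm, fpOperator_edgeChart_sub_one, chartL_neg, chartQ_neg, Matrix.mul_add, Matrix.mul_add]
    show ghostX H (-chartL H a) + ghostX H (chartQ H a) + ghostX H (chartR H (-a)) = -XA + XB + XRm
    rw [ghostX_neg']
  -- link sizes
  have hδU : ∀ (b : LandauFree H → E3), (∀ e : ZdEdge 4, ‖freeVec H b e‖ ≤ t) →
      ∀ e ∈ boxEdges 4 (2 * H + 1), ‖((edgeChart H b e : SU2) : Matrix (Fin 2) (Fin 2) ℂ) - 1‖ ≤ 4 * t := by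
    intro b hb e _
    have h := norm_coe_expPauli_sub_one_le (freeVec H b e) ((hb e).trans ht1)
    exact h.trans (by linarith [hb e])
  have hδA : ∀ e ∈ boxEdges 4 (2 * H + 1), ‖chartL H a e‖ ≤ 3 * t := fun e _ =>
    (norm_su2Coord_chart_le (freeVec H a e)).trans (by linarith [hat' e])
  have hδB : ∀ e ∈ boxEdges 4 (2 * H + 1), ‖chartQ H a e‖ ≤ t ^ 2 / 2 := fun e _ => by
    refine (norm_quadScalar_le (freeVec H a e)).trans ?_
    have := hat' e
    have h0 := norm_nonneg (freeVec H a e)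
    nlinarith
  have hδRp : ∀ e ∈ boxEdges 4 (2 * H + 1), ‖chartR H a e‖ ≤ t ^ 3 := fun e _ => by
    refine (norm_chartRem_le (freeVec H a e) ((hat' e).trans ht1)).trans ?_
    exact pow_le_pow_left₀ (norm_nonneg _) (hat' e) 3
  have hδRm : ∀ e ∈ boxEdges 4 (2 * H + 1), ‖chartR H (-a) e‖ ≤ t ^ 3 := fun e _ => by
    refine (norm_chartRem_le (freeVec H (-a) e) ((hat'm e).trans ht1)).trans ?_
    exact pow_le_pow_left₀ (norm_nonneg _) (hat'm e) 3
  have hδS : ∀ e ∈ boxEdges 4 (2 * H + 1), ‖(chartR H a + chartR H (-a)) e‖ ≤ 5 / 48 * t ^ 4 := fun e _ => by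
    rw [Pi.add_apply]
    refine (norm_chartR_add_chartR_neg_le a e ((hat' e).trans ht1)).trans ?_
    exact mul_le_mul_of_nonneg_left (pow_le_pow_left₀ (norm_nonneg _) (hat' e) 4) (by norm_num)
  have hδD : ∀ e ∈ boxEdges 4 (2 * H + 1), ‖(chartR H a - chartR H (-a)) e‖ ≤ 2 * t ^ 3 := fun e _ => by
    rw [Pi.sub_apply]
    refine (norm_chartR_sub_chartR_neg_le a e ((hat' e).trans ht1)).trans ?_
    exact mul_le_mul_of_nonneg_left (pow_le_pow_left₀ (norm_nonneg _) (hat' e) 3) (by norm_num)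
  -- operator bound and the third-order log-det expansions
  set ρ : ℝ := 1344 * (H : ℝ) ^ 2 * t with hρ
  have hρ0 : 0 ≤ ρ := by positivity
  have hρ12 : ρ ≤ 1 / 2 := by rw [hρ]; nlinarith
  have hop : ∀ (b : LandauFree H → E3), (∀ e : ZdEdge 4, ‖freeVec H b e‖ ≤ t) →
      ∀ v, (F₁⁻¹ * (fpOperator H (edgeChart H b) - F₁)) *ᵥ v ⬝ᵥ (F₁⁻¹ * (fpOperator H (edgeChart H b) - F₁)) *ᵥ v ≤ ρ ^ 2 * (v ⬝ᵥ v) := by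
    intro b hb v
    have h := ghost_opBound hH (edgeChart H b) (hδU b hb) v
    rw [hρ]
    calc _ ≤ (336 * (H : ℝ) ^ 2 * (4 * t)) ^ 2 * (v ⬝ᵥ v) := h
      _ = (1344 * (H : ℝ) ^ 2 * t) ^ 2 * (v ⬝ᵥ v) := by ring
  -- ### Hilbert–Schmidt sizes (before any determinant enters the context)
  have hnI16 : (Fintype.card ↥(interiorSites H) : ℝ) ≤ 16 * (H : ℝ) ^ 4 := by
    rw [Fintype.card_coe]; exact PhiTaylorProof.card_interiorSites_le H
  have ht4 : 0 ≤ t ^ 4 := pow_nonneg ht0 4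
  have ht2 : t ^ 2 ≤ 1 := pow_le_one₀ ht0 ht1
  have h548 : (0 : ℝ) ≤ 5 / 48 * t ^ 4 := mul_nonneg (by norm_num) ht4
  have hsA := sum_sq_ghostX_le hG0 hcol (chartL H a) hδA
  have hsB := sum_sq_ghostX_le hG0 hcol (chartQ H a) hδB
  have hsRp := sum_sq_ghostX_le hG0 hcol (chartR H a) hδRp
  have hsRm := sum_sq_ghostX_le hG0 hcol (chartR H (-a)) hδRm
  have hsD := sum_sq_ghostX_le hG0 hcol (chartR H a - chartR H (-a)) hδD
  have htrS := abs_trace_ghostX_le hG0 hCG hGC (chartR H a + chartR H (-a)) h548 hδS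
  generalize hcard : (Fintype.card ↥(interiorSites H) : ℝ) = nI at hnI16 hsA hsB hsRp hsRm hsD htrS
  set κ : ℝ := 20736 * (16 * (H : ℝ) ^ 4) * (Cr * L) with hκ
  have hCrL : 0 ≤ Cr * L := mul_nonneg hCr0 (by linarith)
  have hκ0 : 0 ≤ κ := by rw [hκ]; exact mul_nonneg (mul_nonneg (by norm_num) hH4n) hCrL
  have lift : ∀ {S : ℝ} {δ : ℝ}, S ≤ 20736 * δ ^ 2 * nI * (Cr * L) → S ≤ κ * δ ^ 2 := by
    intro S δ h
    have h0 : (0 : ℝ) ≤ 20736 * δ ^ 2 := mul_nonneg (by norm_num) (sq_nonneg _)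
    refine (h.trans (mul_le_mul_of_nonneg_right (mul_le_mul_of_nonneg_left hnI16 h0) hCrL)).trans (le_of_eq ?_)
    rw [hκ]; ring
  have hsA' : ∑ p, ∑ q, XA p q ^ 2 ≤ 9 * κ * t ^ 2 := (lift hsA).trans (le_of_eq (by ring))
  have hsB' : ∑ p, ∑ q, XB p q ^ 2 ≤ κ * t ^ 4 / 4 := (lift hsB).trans (le_of_eq (by ring))
  have hsRp' : ∑ p, ∑ q, XRp p q ^ 2 ≤ κ * t ^ 6 := (lift hsRp).trans (le_of_eq (by ring))
  have hsRm' : ∑ p, ∑ q, XRm p q ^ 2 ≤ κ * t ^ 6 := (lift hsRm).trans (le_of_eq (by ring))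
  have hDX : XRp - XRm = ghostX H (chartR H a - chartR H (-a)) := by rw [sub_eq_add_neg, ← ghostX_neg', ← ghostX_add, ← sub_eq_add_neg]
  have hsD' : ∑ p, ∑ q, (XRp - XRm) p q ^ 2 ≤ 4 * κ * t ^ 6 := by rw [hDX]; exact (lift hsD).trans (le_of_eq (by ring))
  have htrS' : |(ghostX H (chartR H a + chartR H (-a))).trace| ≤ 144 * CG * (5 / 48 * t ^ 4) * (16 * (H : ℝ) ^ 4) :=
    htrS.trans (mul_le_mul_of_nonneg_left hnI16 (mul_nonneg (mul_nonneg (by norm_num) hCG) h548))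
  -- the even/odd regrouping `X± = ±X_A + E±`
  obtain ⟨Ep, hEp⟩ : ∃ E : Matrix (↥(interiorSites H) × Fin 3) (↥(interiorSites H) × Fin 3) ℝ, E = XB + XRp := ⟨_, rfl⟩
  obtain ⟨Em, hEm⟩ : ∃ E : Matrix (↥(interiorSites H) × Fin 3) (↥(interiorSites H) × Fin 3) ℝ, E = XB + XRm := ⟨_, rfl⟩
  have hXp' : Xp = XA + Ep := by rw [hXpsplit, hEp]; abel
  have hXm' : Xm = -XA + Em := by rw [hXmsplit, hEm]; abel
  have hE : ∀ {XR E : Matrix (↥(interiorSites H) × Fin 3) (↥(interiorSites H) × Fin 3) ℝ}, E = XB + XR → ∑ p, ∑ q, XR p q ^ 2 ≤ κ * t ^ 6 →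
      ∑ p, ∑ q, E p q ^ 2 ≤ 5 / 2 * κ * t ^ 4 := by
    intro XR E hE hR
    rw [hE]
    refine (sum_sq_add_le XB XR).trans ?_
    have ht6 : κ * t ^ 6 ≤ κ * t ^ 4 := by
      rw [show t ^ 6 = t ^ 4 * t ^ 2 by ring]; exact mul_le_mul_of_nonneg_left (mul_le_of_le_one_right ht4 ht2) hκ0
    linarith
  have hsEp := hE hEp hsRp'
  have hsEm := hE hEm hsRm'
  have hX3 : ∀ {X XR : Matrix (↥(interiorSites H) × Fin 3) (↥(interiorSites H) × Fin 3) ℝ} {σ : ℝ}, X = σ • XA + XB + XR →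
      (σ = 1 ∨ σ = -1) → ∑ p, ∑ q, XR p q ^ 2 ≤ κ * t ^ 6 → ∑ p, ∑ q, X p q ^ 2 ≤ 123 / 4 * κ * t ^ 2 := by
    intro X XR σ hX hs hR
    have hA2 : ∑ p, ∑ q, (σ • XA) p q ^ 2 = ∑ p, ∑ q, XA p q ^ 2 := by
      refine Finset.sum_congr rfl fun p _ => Finset.sum_congr rfl fun q _ => ?_
      rw [Matrix.smul_apply, smul_eq_mul, mul_pow]
      rcases hs with h | h <;> simp [h]
    rw [hX]
    refine (sum_sq_add₃_le (σ • XA) XB XR).trans ?_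
    rw [hA2]
    have ht62 : κ * t ^ 6 ≤ κ * t ^ 2 := by
      rw [show t ^ 6 = t ^ 2 * t ^ 4 by ring]
      exact mul_le_mul_of_nonneg_left (mul_le_of_le_one_right (sq_nonneg t) (pow_le_one₀ ht0 ht1)) hκ0
    have ht42 : κ * t ^ 4 / 4 ≤ κ * t ^ 2 / 4 := by
      rw [show t ^ 4 = t ^ 2 * t ^ 2 by ring]
      exact div_le_div_of_nonneg_right (mul_le_mul_of_nonneg_left (mul_le_of_le_one_right (sq_nonneg t) ht2) hκ0) (by norm_num)
    linarith
  have hsXp := hX3 (X := Xp) (σ := 1) (XR := XRp) (by rw [one_smul]; exact hXpsplit) (Or.inl rfl) hsRp'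
  have hsXm := hX3 (X := Xm) (σ := -1) (XR := XRm) (by rw [neg_one_smul]; exact hXmsplit) (Or.inr rfl) hsRm'
  have hρ2b : ρ ^ 2 ≤ 1806336 * (16 * (H : ℝ) ^ 4) * t ^ 2 := by
    have h0 : 0 ≤ (H : ℝ) ^ 4 * t ^ 2 := mul_nonneg (pow_nonneg hH0 4) (sq_nonneg t)
    rw [hρ, show (1344 * (H : ℝ) ^ 2 * t) ^ 2 = 1806336 * ((H : ℝ) ^ 4 * t ^ 2) by ring,
      show 1806336 * (16 * (H : ℝ) ^ 4) * t ^ 2 = 1806336 * 16 * ((H : ℝ) ^ 4 * t ^ 2) by ring]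
    linarith only [h0]
  have hρ20 : 0 ≤ ρ ^ 2 / 2 := div_nonneg (sq_nonneg ρ) zero_le_two
  -- ### the constant bookkeeping (pure arithmetic, done before the determinants enter)
  have hH4 : (0 : ℝ) ≤ (H : ℝ) ^ 4 := pow_nonneg hH0 4
  have hH8 : (0 : ℝ) ≤ (H : ℝ) ^ 8 := pow_nonneg hH0 8
  have hH48 : (H : ℝ) ^ 4 ≤ (H : ℝ) ^ 8 := pow_le_pow_right₀ hH' (by norm_num)
  have hL0 : 0 ≤ L := by linarith
  have hL8 : (1 + Real.log (H : ℝ)) ^ 8 = L * L := by rw [hLdef]; ring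
  have hL1 : L ≤ L * L := le_mul_of_one_le_right hL0 hL
  have hκe : κ = 331776 * Cr * ((H : ℝ) ^ 4 * L) := by rw [hκ]; ring
  obtain ⟨P, hP⟩ : ∃ P : ℝ, P = (H : ℝ) ^ 8 * (L * L) := ⟨_, rfl⟩
  have hP1 : (H : ℝ) ^ 4 * L ≤ P := by rw [hP]; exact mul_le_mul hH48 hL1 hL0 hH8
  have hP2 : ((H : ℝ) ^ 4 * L) * ((H : ℝ) ^ 4 * L) = P := by rw [hP]; ring
  have hP3 : (H : ℝ) ^ 4 * ((H : ℝ) ^ 4 * L) ≤ P := by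
    rw [hP, show (H : ℝ) ^ 4 * ((H : ℝ) ^ 4 * L) = (H : ℝ) ^ 8 * L by ring]; exact mul_le_mul_of_nonneg_left hL1 hH8
  have hP4 : (H : ℝ) ^ 4 ≤ P := le_trans (le_mul_of_one_le_right hH4 hL) hP1
  have hP5 : (1 : ℝ) ≤ P := le_trans (one_le_pow₀ hH' : (1:ℝ) ≤ (H : ℝ) ^ 4) hP4
  have hCr2 : 0 ≤ (331776 * Cr) ^ 2 := sq_nonneg _
  have c1 : (0 : ℝ) ≤ 27776916 * 16 * 331776 * Cr := by linarith
  have c2 : (0 : ℝ) ≤ 15 * CG * 16 := by linarith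
  have c3 : (0 : ℝ) ≤ 60 * 331776 * Cr := by linarith
  have b1 : 27776916 * (16 * (H : ℝ) ^ 4) * κ ≤ (27776916 * 16 * 331776 * Cr) * P := by
    rw [show 27776916 * (16 * (H : ℝ) ^ 4) * κ = (27776916 * 16 * 331776 * Cr) * ((H : ℝ) ^ 4 * ((H : ℝ) ^ 4 * L)) by rw [hκe]; ring]
    exact mul_le_mul_of_nonneg_left hP3 c1
  have b2 : 15 * CG * (16 * (H : ℝ) ^ 4) ≤ (15 * CG * 16) * P := by
    rw [show 15 * CG * (16 * (H : ℝ) ^ 4) = (15 * CG * 16) * (H : ℝ) ^ 4 by ring]; exact mul_le_mul_of_nonneg_left hP4 c2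
  have b3 : 60 * κ ≤ (60 * 331776 * Cr) * P := by
    rw [show 60 * κ = (60 * 331776 * Cr) * ((H : ℝ) ^ 4 * L) by rw [hκe]; ring]; exact mul_le_mul_of_nonneg_left hP1 c3
  have b4 : 60 * κ ^ 2 ≤ (60 * (331776 * Cr) ^ 2) * P := by
    rw [show 60 * κ ^ 2 = (60 * (331776 * Cr) ^ 2) * (((H : ℝ) ^ 4 * L) * ((H : ℝ) ^ 4 * L)) by rw [hκe]; ring, hP2]
  have b5 : (60 : ℝ) ≤ 60 * P := by linarith
  have hsum : (27776916 * (16 * (H : ℝ) ^ 4) * κ + 15 * CG * (16 * (H : ℝ) ^ 4) + 60 * κ + 60 * κ ^ 2 + 60) * t ^ 4 ≤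
      (27776916 * 16 * 331776 * Cr + 15 * CG * 16 + 60 * 331776 * Cr + 60 * (331776 * Cr) ^ 2 + 60) * (H : ℝ) ^ 8 * (1 + Real.log (H : ℝ)) ^ 8 * t ^ 4 := by
    rw [hL8, show (27776916 * 16 * 331776 * Cr + 15 * CG * 16 + 60 * 331776 * Cr + 60 * (331776 * Cr) ^ 2 + 60) * (H : ℝ) ^ 8 * (L * L) * t ^ 4 =
      ((27776916 * 16 * 331776 * Cr + 15 * CG * 16 + 60 * 331776 * Cr + 60 * (331776 * Cr) ^ 2 + 60) * P) * t ^ 4 by rw [hP]; ring]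
    exact mul_le_mul_of_nonneg_right (by linarith) ht4
  -- ### the third-order log-det expansions and `ghostLogRatio (±a) = log |det (1 + X±)|`
  obtain ⟨hdetp, hlogp⟩ := LogDetHS.logDet_hs4 Xp hρ0 hρ12 (hop a hat')
  obtain ⟨hdetm, hlogm⟩ := LogDetHS.logDet_hs4 Xm hρ0 hρ12 (hop (-a) hat'm)
  have hF₁unit : IsUnit F₁.det := SpectralFloor.isUnit_det_fpOperator_one hH
  have hglr : ∀ (b : LandauFree H → E3) (X : Matrix (↥(interiorSites H) × Fin 3) (↥(interiorSites H) × Fin 3) ℝ),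
      X = F₁⁻¹ * (fpOperator H (edgeChart H b) - F₁) → (1 + X).det ≠ 0 → ghostLogRatio H b = Real.log |(1 + X).det| := by
    intro b X hX hdet
    have hFU : fpOperator H (edgeChart H b) = F₁ * (1 + X) := by
      rw [hX, Matrix.mul_add, Matrix.mul_one, ← Matrix.mul_assoc, Matrix.mul_nonsing_inv _ hF₁unit, Matrix.one_mul]
      abel
    unfold ghostLogRatio
    rw [← hF₁, hFU, Matrix.det_mul, abs_mul, Real.log_mul (abs_ne_zero.2 hF₁unit.ne_zero) (abs_ne_zero.2 hdet)]
    ring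
  have hgp : ghostLogRatio H a = Real.log |(1 + Xp).det| := hglr a Xp hXp hdetp
  have hgm : ghostLogRatio H (-a) = Real.log |(1 + Xm).det| := hglr (-a) Xm hXm hdetm
  clear hdetp hdetm hF₁unit hglr
  have hr4p' := hlogp.trans (mul_le_mul_of_nonneg_left hsXp hρ20)
  have hr4m' := hlogm.trans (mul_le_mul_of_nonneg_left hsXm hρ20)
  -- ### traces, the quadratic form, and the algebra of the even symmetrisation
  have htrA : XA.trace = 0 := trace_ghostX_chartL a
  have hq : quadVal (ghostM H) a = XB.trace - 1 / 2 * (XA * XA).trace := quadVal_ghostM a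
  have t1p : Xp.trace = XB.trace + XRp.trace := by rw [hXpsplit, Matrix.trace_add, Matrix.trace_add, htrA, zero_add]
  have t1m : Xm.trace = XB.trace + XRm.trace := by rw [hXmsplit, Matrix.trace_add, Matrix.trace_add, Matrix.trace_neg, htrA, neg_zero, zero_add]
  have t2p : (Xp * Xp).trace = (XA * XA).trace + 2 * (XA * Ep).trace + (Ep * Ep).trace := by rw [hXp']; exact trace_sq_add XA Ep
  have t2m : (Xm * Xm).trace = (XA * XA).trace - 2 * (XA * Em).trace + (Em * Em).trace := by
    rw [hXm', trace_sq_add (-XA) Em]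
    simp only [neg_mul, mul_neg, neg_neg, Matrix.trace_neg]; ring
  have t3p : (Xp * Xp * Xp).trace = (XA * XA * XA).trace + 3 * (XA * XA * Ep).trace + 3 * (XA * Ep * Ep).trace + (Ep * Ep * Ep).trace := by
    rw [hXp']; exact trace_cube_add XA Ep
  have t3m : (Xm * Xm * Xm).trace = -(XA * XA * XA).trace + 3 * (XA * XA * Em).trace - 3 * (XA * Em * Em).trace + (Em * Em * Em).trace := by
    rw [hXm', trace_cube_add (-XA) Em]
    simp only [neg_mul, mul_neg, neg_neg, Matrix.trace_neg]; ring
  have hD : (XA * Ep).trace - (XA * Em).trace = (XA * (XRp - XRm)).trace := by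
    rw [hEp, hEm, Matrix.mul_sub, Matrix.trace_sub, Matrix.mul_add, Matrix.mul_add, Matrix.trace_add, Matrix.trace_add]; ring
  have hS : XRp.trace + XRm.trace = (ghostX H (chartR H a + chartR H (-a))).trace := by rw [ghostX_add, Matrix.trace_add]
  obtain ⟨r4p, hr4p⟩ : ∃ r : ℝ, r = Real.log |(1 + Xp).det| - Xp.trace + (Xp * Xp).trace / 2 - (Xp * Xp * Xp).trace / 3 := ⟨_, rfl⟩
  obtain ⟨r4m, hr4m⟩ : ∃ r : ℝ, r = Real.log |(1 + Xm).det| - Xm.trace + (Xm * Xm).trace / 2 - (Xm * Xm * Xm).trace / 3 := ⟨_, rfl⟩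
  rw [← hr4p] at hr4p'
  rw [← hr4m] at hr4m'
  have hident : (ghostLogRatio H a + ghostLogRatio H (-a)) / 2 - quadVal (ghostM H) a =
      (r4p + r4m) / 2 + (ghostX H (chartR H a + chartR H (-a))).trace / 2 - (XA * (XRp - XRm)).trace / 2
        - ((Ep * Ep).trace + (Em * Em).trace) / 4 + ((XA * XA * Ep).trace + (XA * XA * Em).trace) / 2
        + ((XA * Ep * Ep).trace - (XA * Em * Em).trace) / 2 + ((Ep * Ep * Ep).trace + (Em * Em * Em).trace) / 6 := by
    rw [hgp, hgm, hq, ← hS, ← hD]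
    have ep : Real.log |(1 + Xp).det| = r4p + Xp.trace - (Xp * Xp).trace / 2 + (Xp * Xp * Xp).trace / 3 := by rw [hr4p]; ring
    have em : Real.log |(1 + Xm).det| = r4m + Xm.trace - (Xm * Xm).trace / 2 + (Xm * Xm * Xm).trace / 3 := by rw [hr4m]; ring
    rw [ep, em, t1p, t1m, t2p, t2m, t3p, t3m]
    ring
  -- ### conclude
  rw [hident]
  have s0 : ∀ (M : Matrix (↥(interiorSites H) × Fin 3) (↥(interiorSites H) × Fin 3) ℝ), 0 ≤ ∑ p, ∑ q, M p q ^ 2 :=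
    fun M => Finset.sum_nonneg fun p _ => Finset.sum_nonneg fun q _ => sq_nonneg _
  have hfin := final_arith4 (h4 := 16 * (H : ℝ) ^ 4) ht0 ht1 hκ0 hH4n hCG hρ2b (s0 XA) hsA' (s0 Ep) hsEp (s0 Em) hsEm hsD' hr4p' hr4m' htrS'
    (abs_trace_mul_le_hs XA (XRp - XRm)) (abs_trace_mul_le_hs Ep Ep) (abs_trace_mul_le_hs Em Em)
    (abs_trace_mul_mul_le_hs XA XA Ep) (abs_trace_mul_mul_le_hs XA XA Em) (abs_trace_mul_mul_le_hs XA Ep Ep) (abs_trace_mul_mul_le_hs XA Em Em)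
    (abs_trace_mul_mul_le_hs Ep Ep Ep) (abs_trace_mul_mul_le_hs Em Em Em)
  exact hfin.trans hsum

end Summit.QuantumFields.YangMills.Theorems.AllWindowsColdBoxBoxHighLine

end
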